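import Literature.AlgebraicGeometry.Motives.ComplexPointsSubmersion
import HarnessLib

/-!
# Change of holomorphic algebraic chart: analyticity in ONE algebraic chart gives
# differentiability in EVERY algebraic chart

Family `hodge`, layer `Literature/AlgebraicGeometry/Motives`. For a `ℂ`-scheme `X` locally of
finite type and smooth of relative dimension `d`, the tree's holomorphic algebraic charts
`ComplexPoints.algebraicChart X d P : X(ℂ) ⇀ ℂᵈ` form a `C^ω` atlas
(`ComplexPoints.contDiffOn_algebraicChart_symm_trans`, `isManifold_algebraicChart`; Serre GAGA
§2 n°5 Prop. 2). This file spells out the elementary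
consequence used when a function `F : X(ℂ) → E` is known to be analytic in the coordinates of the
chart at ONE point `P` on a set `W ⊆ (algebraicChart X d P).source`, and one wants it
`ℂ`-differentiable in the coordinates of the chart at ANY point `Q` (on the part of the chart
domain lying over `W`):

* (input, ★ `ComplexPoints.contDiffOn_algebraicChart_symm_trans` of `Motives/ComplexPointsSubmersion`:
  the transition map `algebraicChart Q ∘ (algebraicChart P)⁻¹` is `C^ω` on its domain;)
* `differentiableOn_comp_algebraicChart_symm_of_differentiableAt` — pointwise-differentiable in the
  chart at `P` over `W` ⇒ `DifferentiableOn` in the chart at `Q` over `W`;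
  `…_of_analyticOnNhd`, `…_of_differentiableOn` (open `W`) — the two usual hypotheses;
* `analyticOnNhd_comp_algebraicChart_symm_of_univ`, `image_val_subset_algebraicChart_source_of_univ`,
  `image_eq_algebraicChart_image_of_univ` and the seam corollary
  `differentiableOn_comp_algebraicChart_symm_of_analyticOnNhd_univ` — the same statements when the
  chart at `P` is presented on the subtype `↥(Set.univ : Set X(ℂ))` as
  `ψ = (Homeomorph.Set.univ _).transOpenPartialHomeomorph (algebraicChart X d P)` (the spelling
  produced by chart-ball frame statements phrased over `Set.univ`), for any `W' ⊆ val '' W`.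

Used by the (U)-road of cell hodgecm-mathlib (U-e P4, seam (S-5): Griffiths frames are analytic in
the chart at the centre of a chart ball; the period map must be holomorphic in every algebraic
chart). Nothing here is specific to that consumer.

## References

* [SerreGAGA1956] J.-P. Serre, Géométrie algébrique et géométrie analytique, Ann. Inst. Fourier 6
  (1956), §2 n°5 Prop. 2.
-/

noncomputable section

open scoped Manifold ContDiff Topology
open Set Function

namespace Literature.AlgebraicGeometry.Motives.ComplexPoints

variable {X : SchemeOver ℂ} {d : ℕ} [AlgebraicGeometry.LocallyOfFiniteType X.hom]
  [AlgebraicGeometry.SmoothOfRelativeDimension d X.hom]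

/-- **Differentiable in the chart at `P` over `W` ⇒ differentiable in the chart at `Q` over `W`.**
If `W ⊆ (algebraicChart P).source` and `F ∘ (algebraicChart P)⁻¹` is `ℂ`-differentiable at
`algebraicChart P y` for every `y ∈ W`, then `F ∘ (algebraicChart Q)⁻¹` is `ℂ`-differentiable on
`(algebraicChart Q).target ∩ (algebraicChart Q)⁻¹' W` (compose with the `C^ω` transition map).
[cite: SerreGAGA1956, §2 n°5 Prop. 2] -/
theorem differentiableOn_comp_algebraicChart_symm_of_differentiableAt {E : Type*}
    [NormedAddCommGroup E] [NormedSpace ℂ E] (F : ComplexPoints X → E) (P : ComplexPoints X)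
    {W : Set (ComplexPoints X)} (hW : W ⊆ (algebraicChart X d P).source)
    (hF : ∀ y ∈ W, DifferentiableAt ℂ (F ∘ (algebraicChart X d P).symm) (algebraicChart X d P y))
    (Q : ComplexPoints X) :
    DifferentiableOn ℂ (F ∘ (algebraicChart X d Q).symm)
      ((algebraicChart X d Q).target ∩ (algebraicChart X d Q).symm ⁻¹' W) := by
  intro z hz
  set cP := algebraicChart X d P with hcP
  set cQ := algebraicChart X d Q with hcQ
  have hsub : cQ.target ∩ cQ.symm ⁻¹' W ⊆ cQ.target ∩ cQ.symm ⁻¹' cP.source :=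
    fun w hw ↦ ⟨hw.1, hW hw.2⟩
  have hT := contDiffOn_algebraicChart_symm_trans X d Q P
  simp only [OpenPartialHomeomorph.trans_source, OpenPartialHomeomorph.symm_source,
    OpenPartialHomeomorph.coe_trans] at hT
  have h1 : DifferentiableWithinAt ℂ (cP ∘ cQ.symm) (cQ.target ∩ cQ.symm ⁻¹' W) z :=
    ((hT.differentiableOn (by simp)) z (hsub hz)).mono hsub
  have h2 : DifferentiableAt ℂ (F ∘ cP.symm) (cP (cQ.symm z)) := hF _ hz.2
  have h3 : DifferentiableWithinAt ℂ ((F ∘ cP.symm) ∘ (cP ∘ cQ.symm)) (cQ.target ∩ cQ.symm ⁻¹' W) z :=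
    h2.comp_differentiableWithinAt z h1
  refine h3.congr (fun w hw ↦ ?_) ?_
  · change F (cQ.symm w) = F (cP.symm (cP (cQ.symm w)))
    rw [cP.left_inv (hW hw.2)]
  · change F (cQ.symm z) = F (cP.symm (cP (cQ.symm z)))
    rw [cP.left_inv (hW hz.2)]

/-- **Analytic in the chart at `P` on `algebraicChart P '' W` ⇒ differentiable in every chart over `W`.**
[cite: SerreGAGA1956, §2 n°5 Prop. 2] -/
theorem differentiableOn_comp_algebraicChart_symm_of_analyticOnNhd {E : Type*}
    [NormedAddCommGroup E] [NormedSpace ℂ E] (F : ComplexPoints X → E) (P : ComplexPoints X)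
    {W : Set (ComplexPoints X)} (hW : W ⊆ (algebraicChart X d P).source)
    (hF : AnalyticOnNhd ℂ (F ∘ (algebraicChart X d P).symm) (algebraicChart X d P '' W))
    (Q : ComplexPoints X) :
    DifferentiableOn ℂ (F ∘ (algebraicChart X d Q).symm)
      ((algebraicChart X d Q).target ∩ (algebraicChart X d Q).symm ⁻¹' W) :=
  differentiableOn_comp_algebraicChart_symm_of_differentiableAt F P hW
    (fun _ hy ↦ (hF _ (Set.mem_image_of_mem _ hy)).differentiableAt) Q

/-- **Differentiable in the chart at `P` on `algebraicChart P '' W`, `W` open ⇒ differentiable in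
every chart over `W`.** [cite: SerreGAGA1956, §2 n°5 Prop. 2] -/
theorem differentiableOn_comp_algebraicChart_symm_of_differentiableOn {E : Type*}
    [NormedAddCommGroup E] [NormedSpace ℂ E] (F : ComplexPoints X → E) (P : ComplexPoints X)
    {W : Set (ComplexPoints X)} (hWo : IsOpen W) (hW : W ⊆ (algebraicChart X d P).source)
    (hF : DifferentiableOn ℂ (F ∘ (algebraicChart X d P).symm) (algebraicChart X d P '' W))
    (Q : ComplexPoints X) :
    DifferentiableOn ℂ (F ∘ (algebraicChart X d Q).symm)
      ((algebraicChart X d Q).target ∩ (algebraicChart X d Q).symm ⁻¹' W) :=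
  differentiableOn_comp_algebraicChart_symm_of_differentiableAt F P hW
    (fun _ hy ↦ hF.differentiableAt
      (((algebraicChart X d P).isOpen_image_of_subset_source hWo hW).mem_nhds
        (Set.mem_image_of_mem _ hy))) Q

/-! ### The chart at `P` presented on the subtype `↥(Set.univ)` -/

section UnivSubtype

variable {M : Type*} [TopologicalSpace M] {H : Type*} [TopologicalSpace H]
  (e : OpenPartialHomeomorph M H)

/-- `(univ ≃ₜ M).trans e` maps `W ⊆ ↥univ` onto `e '' (val '' W)`. [folklore] -/
private theorem univ_transOpenPartialHomeomorph_image (W : Set (Set.univ : Set M)) :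
    (Homeomorph.Set.univ M).transOpenPartialHomeomorph e '' W = e '' (Subtype.val '' W) := by
  rw [Set.image_image]
  rfl

/-- Reading a function through the inverse of `(univ ≃ₜ M).trans e` is reading its extension to `M`
through `e⁻¹`. [folklore] -/
private theorem univ_transOpenPartialHomeomorph_symm_comp {E : Type*}
    (G : ↥(Set.univ : Set M) → E) :
    G ∘ ((Homeomorph.Set.univ M).transOpenPartialHomeomorph e).symm =
      (fun y ↦ G ⟨y, Set.mem_univ y⟩) ∘ e.symm :=
  rfl

/-- `W ⊆ source ((univ ≃ₜ M).trans e)` iff `val '' W ⊆ e.source`. [folklore] -/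
private theorem univ_transOpenPartialHomeomorph_subset_source_iff (W : Set (Set.univ : Set M)) :
    W ⊆ ((Homeomorph.Set.univ M).transOpenPartialHomeomorph e).source ↔ Subtype.val '' W ⊆ e.source := by
  rw [Set.image_subset_iff]
  rfl

end UnivSubtype

/-- **Un-subtyping the chart at `P` (analyticity).** If `ψ` is the algebraic chart at `P` presented on
`↥univ`, analyticity of `G ∘ ψ⁻¹` on `ψ '' W` is analyticity of the extension `y ↦ G ⟨y, _⟩` read
through `(algebraicChart P)⁻¹` on `algebraicChart P '' (val '' W)`. [cite: SerreGAGA1956, §2 n°5 Prop. 2] -/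
theorem analyticOnNhd_comp_algebraicChart_symm_of_univ {E : Type*}
    [NormedAddCommGroup E] [NormedSpace ℂ E] (G : ↥(Set.univ : Set (ComplexPoints X)) → E)
    (P : ComplexPoints X) {ψ : OpenPartialHomeomorph (Set.univ : Set (ComplexPoints X)) (Fin d → ℂ)}
    (hψ : ψ = (Homeomorph.Set.univ (ComplexPoints X)).transOpenPartialHomeomorph (algebraicChart X d P))
    {W : Set (Set.univ : Set (ComplexPoints X))} (hG : AnalyticOnNhd ℂ (G ∘ ψ.symm) (ψ '' W)) :
    AnalyticOnNhd ℂ ((fun y ↦ G ⟨y, Set.mem_univ y⟩) ∘ (algebraicChart X d P).symm)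
      (algebraicChart X d P '' (Subtype.val '' W)) := by
  subst hψ
  rwa [univ_transOpenPartialHomeomorph_image, univ_transOpenPartialHomeomorph_symm_comp] at hG

/-- **Un-subtyping the chart at `P` (source condition).** `W ⊆ ψ.source` for the chart at `P`
presented on `↥univ` means `val '' W ⊆ (algebraicChart P).source`. [cite: SerreGAGA1956, §2 n°5 Prop. 2] -/
theorem image_val_subset_algebraicChart_source_of_univ (P : ComplexPoints X)
    {ψ : OpenPartialHomeomorph (Set.univ : Set (ComplexPoints X)) (Fin d → ℂ)}
    (hψ : ψ = (Homeomorph.Set.univ (ComplexPoints X)).transOpenPartialHomeomorph (algebraicChart X d P))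
    {W : Set (Set.univ : Set (ComplexPoints X))} (hW : W ⊆ ψ.source) :
    Subtype.val '' W ⊆ (algebraicChart X d P).source := by
  subst hψ
  rwa [univ_transOpenPartialHomeomorph_subset_source_iff] at hW

/-- **Un-subtyping the chart at `P` (image of a subset).** For the chart at `P` presented on `↥univ`,
`ψ '' W = algebraicChart P '' (val '' W)`. [cite: SerreGAGA1956, §2 n°5 Prop. 2] -/
theorem image_eq_algebraicChart_image_of_univ (P : ComplexPoints X)
    {ψ : OpenPartialHomeomorph (Set.univ : Set (ComplexPoints X)) (Fin d → ℂ)}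
    (hψ : ψ = (Homeomorph.Set.univ (ComplexPoints X)).transOpenPartialHomeomorph (algebraicChart X d P))
    (W : Set (Set.univ : Set (ComplexPoints X))) :
    ψ '' W = algebraicChart X d P '' (Subtype.val '' W) := by
  subst hψ
  exact univ_transOpenPartialHomeomorph_image _ W

/-- **Seam form.** If `ψ` is the chart at `P` presented on `↥univ` and `G ∘ ψ⁻¹` is analytic on
`ψ '' W` with `W ⊆ ψ.source`, then the extension `y ↦ G ⟨y, _⟩` of `G` is `ℂ`-differentiable in
EVERY algebraic chart over any `W' ⊆ val '' W`. [cite: SerreGAGA1956, §2 n°5 Prop. 2] -/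
theorem differentiableOn_comp_algebraicChart_symm_of_analyticOnNhd_univ {E : Type*}
    [NormedAddCommGroup E] [NormedSpace ℂ E] (G : ↥(Set.univ : Set (ComplexPoints X)) → E)
    (P : ComplexPoints X) {ψ : OpenPartialHomeomorph (Set.univ : Set (ComplexPoints X)) (Fin d → ℂ)}
    (hψ : ψ = (Homeomorph.Set.univ (ComplexPoints X)).transOpenPartialHomeomorph (algebraicChart X d P))
    {W : Set (Set.univ : Set (ComplexPoints X))} (hW : W ⊆ ψ.source)
    (hG : AnalyticOnNhd ℂ (G ∘ ψ.symm) (ψ '' W)) {W' : Set (ComplexPoints X)}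
    (hW' : W' ⊆ Subtype.val '' W) (Q : ComplexPoints X) :
    DifferentiableOn ℂ ((fun y ↦ G ⟨y, Set.mem_univ y⟩) ∘ (algebraicChart X d Q).symm)
      ((algebraicChart X d Q).target ∩ (algebraicChart X d Q).symm ⁻¹' W') :=
  differentiableOn_comp_algebraicChart_symm_of_analyticOnNhd _ P
    (hW'.trans (image_val_subset_algebraicChart_source_of_univ P hψ hW))
    ((analyticOnNhd_comp_algebraicChart_symm_of_univ G P hψ hG).mono (Set.image_mono hW')) Q

end Literature.AlgebraicGeometry.Motives.ComplexPoints

end
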